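import Literature.MathematicalPhysics.QuantumFieldTheory.Balaban1983to89.B13Sect2Statements
import Literature.MathematicalPhysics.QuantumFieldTheory.Balaban1983to89.B13PerturbativeStep

/-!
# `Balaban1983to89.B13Term214` — T. Bałaban, *Renormalization group approach to lattice gauge field theories. II.
Cluster expansions*, Commun. Math. Phys. **116** (1988) 1–22 [Balaban1988RG2Cluster]: the GENERIC TERM (2.14) p. 15
of the activity `H(Z)` — its Cauchy-integral device PROVED (the printed `∫₀¹ds(Δ)(1/2πi)∮dσ(Δ)/(σ(Δ) − s(Δ))²`
recovers the parameter differences of (2.8)/(2.1)) and its complex-Gaussian integrand TYPED as named objects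

statement-level skeleton of published theorems with citation tags; proofs where landed; nothing here is a claim about
the Yang–Mills mass gap

PDF held: `paper:balaban1988-cmp116-rg-ii-cluster` (journal page = PDF page + 0); p. 15 read as an image from
`run/shared/lean/pub/pub-balaban/b2b-balaban-ref1/pages/1988-cmp116-rg-II-cluster/1988-cmp116-rg-II-cluster-p015-x2.png`
(context pp. 12–14 from `…-p012-x2.png` … `…-p014-x2.png`).

CITATION HEADER (p. 15 [PDF 15], verbatim): *"To get a bound for H(Z) we consider a term in the sum over 𝐃, P. This
term can be written in the following form:*
`Π_{Δ⊂Z∖Z′₀} ∫₀¹ ds(Δ) (1/2πi) ∫ dσ(Δ)/(σ(Δ) − s(Δ))² Π_{Y∈𝐃} ∫₀¹ dt(Y) (1/2πi) ∫ dτ(Y)/(τ(Y) − t(Y))²`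
`  · ∫dμ₀(X)|_Z exp(−½⟨Γ_k(Z₀, σ(Z))X, C^{(k)}(Z₀, σ(Z))Γ_k(Z₀, σ(Z))X⟩)`
`  · ∫dμ_{C^{(k)}(Z₀,σ(Z))}(B) exp(−⟨B, Γ_k(Z₀, σ(Z))X⟩)`
`  · (−1)^{|P|} χ_{k,Y₀}(B) χᶜ_{k,P}(B) exp[Σ_{Y∈𝐃} τ(Y)𝐕_k(Y, B)],`  (2.14)
*where* `Γ_k(Z₀, σ(Z)) = C*Δ_k(σ(Z))CZ₀ᶜ(C^{(k)})^{1/2}(σ(Z))`.  *We consider it as an analytic function of (𝐔, 𝐉) in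
the space 𝐔^c_{k+1}(X, α₀, α₁), and of the complex parameters σ(Z), τ. This complicates estimates of this expression,
because the operators in it are not symmetric, and the second measure is complex."*  Context (same page, before):
*"The quadratic forms and covariances in H(Z) are analytic functions on the space of configurations (𝐔, 𝐉) …"*; p. 7
(1.24): the same Cauchy device for the `t_□`-derivative of (1.10).

WHAT IS REPRODUCED (unit `lit-balaban-r10` gen 2, reader/typer of CMP 116; SKELETON row `B13.Eq2.14` of
`HOME/lit-balaban-r10/ROWS-B13.md`, «absent (schematic)» at SKELETON v3.8 and ranked in the lead's `ABSENT-RANKED.md`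
(159 dependants)).  (2.14) is the term of `H(Z, Z₀)` ((2.8): `Π_{Δ⊂Z∖Z′₀}∫₀¹ds(Δ)∂/∂s(Δ)` of `∫dμ₀(X)G(…s…)`) for one
`𝐃 ⊂ 𝐃_k` of the Mayer expansion (2.1) (`Π_{Y∈𝐃}∫₀¹dt(Y) … 𝐕_k(Y, B)`, i.e. `∂/∂t(Y)` of `exp[Σ t(Y)𝐕_k(Y, B)]`) and one
`P` of (2.3), with every parameter derivative written as a Cauchy integral.  This file lands:
* Part A — THE CAUCHY DEVICE, PROVED ([folklore] complex analysis at the printed formula, Mathlib's Cauchy formula for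
  the derivative `DifferentiableOn.deriv_eq_smul_circleIntegral`): `cauchyD r f s = (1/2πi)∮_{|σ−s|=r} dσ/(σ − s)² f(σ)`
  (`cauchyD`), `= f′(s)` for `f` holomorphic about the closed disc (`cauchyD_eq_deriv`), hence
  `∫₀¹ds (1/2πi)∮dσ/(σ − s)² f(σ) = f(1) − f(0)` (`integral_cauchyD_eq_sub`) — ONE factor
  `∫₀¹ds(Δ)(1/2πi)∮dσ(Δ)/(σ(Δ) − s(Δ))²` of (2.14) IS the factor `∫₀¹ds(Δ)∂/∂s(Δ)` of (2.8) (= the difference operator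
  `δ_Δ` of `B13MayerDecoupling`); and the ITERATED form: the printed product of such factors over a list of parameters
  (`TopC`), applied to a function separately holomorphic in each parameter on an open set containing the discs around
  `[0, 1]` (`SepHolOn`), equals the iterated difference over the corners `{0,1}^{l}` (`DopC`, `TopC_eq_DopC`) — so the
  (2.14)-form of the term, `term214`, equals the (2.8)×(2.1) difference form (`term214_eq_DopC`).
* Part B — THE INTEGRAND OF (2.14) AS NAMED OBJECTS over the finite-dimensional block model of `B13GaugeDevices` §H /
  `B13Sect2Statements` Part A (real fields `X`, `B`; at complex parameters the operators are COMPLEX matrices acting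
  on real vectors, *"the second measure is complex"*): the complex Gaussian weight / integral / normalised mean
  `cgaussWeight`, `cgaussInt`, `cgaussNorm`, `cgaussMean` (precision `A`, `A⁻¹ = C^{(k)}(Z₀, σ(Z))`; the modulus of the
  weight is the weight of `Re A` — `norm_cgaussWeight`, = `B13PerturbativeStep.norm_cexp_neg_half_quadForm`, the first
  step of (2.15)); the operator `Γ_k(Z₀, σ(Z))` as the composite of the two σ-dependent families it is printed as
  (`Gamma214`, the complex-parameter form of `B13Sect2Statements.gamma26`: `Gamma214_real`); the last line
  `(−1)^{|P|}χ_{k,Y₀}(B)χᶜ_{k,P}(B)exp[Σ_{Y∈𝐃}τ(Y)𝐕_k(Y, B)]` (`F214`); lines 2–3 (`integrand214`, the complex-parameter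
  form of `B13Sect2Statements.G26`); the `X`-integral `∫dμ₀(X)|_Z(…)` (`core214`); and the whole display (`term214` =
  `TopC` over `Z∖Z′₀` in `σ` of `TopC` over `𝐃` in `τ` of `core214`).
NOT ASSERTED: the analyticity of the paper's operators in `σ(Z)` (p. 15, by reference to Sect. 1 and [13]) — it is the
HYPOTHESIS `SepHolOn` where used; nothing of (2.15)–(2.37) (rows B13.Eq2.15 ff., `B13PerturbativeStep`, `B13.lean`).
No named fact (D-0026): every `Prop`-valued declaration is a definition of a regularity class (`SepHolOn`) or a proved
theorem.  HOME: `run/shared/lean/pub/lit-balaban/` (ROWS-B13.md row B13.Eq2.14).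

v1.1 (same unit, 2026-08-21; APPEND-ONLY): Part C — THE REAL-PARAMETER BRIDGE, PROVED: at REAL operators (the point
`σ(Z) = s(Z)` real, in particular `s ≡ 1`, where (2.14)'s lines 2–3 are the integrand of (2.6)/(2.8)) the complex
objects of Part B ARE the real Gaussian objects of `B13GaugeDevices` §H / `B13Sect2Statements` Part A:
`cgaussWeight_real`, `cgaussNorm_real`, `cgaussInt_real`, **`cgaussMean_real`** (`∫dμ` of (2.14) at a real precision
`A` = `B13GaugeDevices.gaussMean A` on complex-valued integrands) and **`integrand214_real`** (lines 2–3 of (2.14) with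
`A`, `Γ_k` real = the function `G` of (2.6), `B13Sect2Statements.G26`, for complex-valued `F`) — so (2.14) is, as the
print says, the analytic continuation in `σ(Z)` of the (2.8)-integrand.  [folklore] linear algebra / Bochner-integral
bookkeeping (`integral_complex_ofReal`, a field hom commutes with the nonsingular inverse); no statement of v1 changed.
-/

noncomputable section

namespace Literature.MathematicalPhysics.QuantumFieldTheory.Balaban1983to89.B13Term214

open Complex MeasureTheory Metric Set Finset Matrix
open scoped Real
open Literature.MathematicalPhysics.QuantumFieldTheory.Balaban1983to89.B13Sect2Statements (gamma26)

/-! ## Part A. The Cauchy-integral form of the parameter derivatives ((2.14) p. 15; the device of (1.24) p. 7) -/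

section CauchyDevice

variable {E : Type*} [NormedAddCommGroup E] [NormedSpace ℂ E] [CompleteSpace E]

/-- One printed factor of (2.14) without its `∫₀¹ds(Δ)`: the Cauchy integral
`(1/2πi) ∮_{|σ−s|=r} dσ/(σ − s)² f(σ)` (print: *"(1/2πi) ∫ dσ(Δ)/(σ(Δ) − s(Δ))²"*, contour a circle of radius `r`
about `s(Δ)` inside the domain of analyticity — p. 16 chooses `|σ(Δ)| ≤ e^{κ₁}`, cf. (2.18)).
[cite: Balaban1988RG2Cluster, (2.14) p.15] -/
def cauchyD (r : ℝ) (f : ℂ → E) (s : ℂ) : E :=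
  (2 * π * I : ℂ)⁻¹ • ∮ σ in C(s, r), (1 / (σ - s) ^ 2) • f σ

/-- The Cauchy formula for the derivative: for `f` holomorphic on a neighbourhood `U` of the closed disc `|σ − s| ≤ r`,
`(1/2πi)∮_{|σ−s|=r} dσ/(σ − s)² f(σ) = f′(s)` — so the factor `∫₀¹ds(Δ)(1/2πi)∮dσ(Δ)/(σ(Δ) − s(Δ))²` of (2.14) is the
factor `∫₀¹ds(Δ) ∂/∂s(Δ)` of (2.8) (Mathlib `DifferentiableOn.deriv_eq_smul_circleIntegral`).
[cite: Balaban1988RG2Cluster, (2.14) p.15] -/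
theorem cauchyD_eq_deriv {U : Set ℂ} {f : ℂ → E} (hf : DifferentiableOn ℂ f U) {s : ℂ} {r : ℝ} (hr : 0 < r)
    (hsub : closedBall s r ⊆ U) : cauchyD r f s = deriv f s := by
  rw [cauchyD, (hf.mono hsub).deriv_eq_smul_circleIntegral hr, inv_smul_smul₀ two_pi_I_ne_zero]

/-- **One variable of (2.14) ⇒ one difference of (2.8)/(2.1)**: for `f` holomorphic on an open `U` containing the
closed `r`-discs about the points of `[0, 1]`,
`∫₀¹ ds (1/2πi)∮_{|σ−s|=r} dσ/(σ − s)² f(σ) = f(1) − f(0)` (Cauchy formula + the fundamental theorem of calculus along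
the real segment). [cite: Balaban1988RG2Cluster, (2.14) p.15] -/
theorem integral_cauchyD_eq_sub {U : Set ℂ} (hU : IsOpen U) {f : ℂ → E} (hf : DifferentiableOn ℂ f U) {r : ℝ}
    (hr : 0 < r) (hsub : ∀ s ∈ Set.uIcc (0 : ℝ) 1, closedBall (s : ℂ) r ⊆ U) :
    ∫ s in (0 : ℝ)..1, cauchyD r f s = f 1 - f 0 := by
  have hmem : ∀ s ∈ Set.uIcc (0 : ℝ) 1, (s : ℂ) ∈ U := fun s hs => hsub s hs (mem_closedBall_self hr.le)
  have hderiv : ∀ s ∈ Set.uIcc (0 : ℝ) 1, HasDerivAt (fun t : ℝ => f t) (deriv f s) s := by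
    intro s hs
    have hd : HasDerivAt f (deriv f s) (s : ℂ) := (hf.differentiableAt (hU.mem_nhds (hmem s hs))).hasDerivAt
    have hc : HasDerivAt (fun t : ℝ => ((id t : ℝ) : ℂ)) ((1 : ℝ) : ℂ) s := (hasDerivAt_id s).ofReal_comp
    have := hd.scomp s hc
    simpa [Function.comp_def] using this
  have hcont : ContinuousOn (fun s : ℝ => deriv f s) (Set.uIcc 0 1) :=
    ((hf.analyticOnNhd hU).deriv.continuousOn).comp continuous_ofReal.continuousOn hmem
  rw [intervalIntegral.integral_congr (fun s hs => cauchyD_eq_deriv hf hr (hsub s hs))]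
  simpa using intervalIntegral.integral_eq_sub_of_hasDerivAt hderiv hcont.intervalIntegrable

variable {ι : Type*} [DecidableEq ι]

/-- The corners of the parameter cube with COMPLEX coordinates: on `S`, `p(i) := 1` if `i ∈ T` else `0`; untouched
off `S` (the evaluation points of the differences produced by the factors of (2.14); complex-parameter form of
`B13MayerDecoupling.corner`). [cite: Balaban1988RG2Cluster, (2.14) p.15] -/
def cornerC (S T : Finset ι) (p : ι → ℂ) : ι → ℂ :=
  fun i => if i ∈ S then (if i ∈ T then 1 else 0) else p i

/-- The iterated difference over the corners `{0,1}^S`: `Σ_{T⊆S} (−1)^{|S∖T|} Φ(corner S T p)` (complex-parameter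
form of `B13MayerDecoupling.Dop`, the σ-term of (1.9)/(2.8)). [cite: Balaban1988RG2Cluster, (2.14) p.15] -/
def DopC (S : Finset ι) (Φ : (ι → ℂ) → E) (p : ι → ℂ) : E :=
  ∑ T ∈ S.powerset, ((-1 : ℂ) ^ (S \ T).card) • Φ (cornerC S T p)

/-- **The printed operator of (2.14)**: `Π_{i∈l} ∫₀¹ ds(i) (1/2πi)∮ dσ(i)/(σ(i) − s(i))²`, applied in the order of the
list `l` to a function `Φ` of the complex parameters, the remaining parameters held at `p`.
[cite: Balaban1988RG2Cluster, (2.14) p.15] -/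
def TopC (r : ℝ) : List ι → ((ι → ℂ) → E) → (ι → ℂ) → E
  | [], Φ, p => Φ p
  | i :: l, Φ, p => ∫ s in (0 : ℝ)..1, cauchyD r (fun z => TopC r l Φ (Function.update p i z)) s

/-- The regularity (2.14) uses, p. 15 *"We consider it as an analytic function … of the complex parameters σ(Z), τ"*:
`Φ` is holomorphic in EACH parameter separately on `U`, at every base point with all parameters in `U` (a DEFINITION
of a regularity class — the hypothesis under which the Cauchy form is rewritten; not asserted for the paper's
functions). [cite: Balaban1988RG2Cluster, (2.14) p.15] -/
def SepHolOn (U : Set ℂ) (Φ : (ι → ℂ) → E) : Prop :=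
  ∀ (i : ι) (p : ι → ℂ), (∀ j, p j ∈ U) → DifferentiableOn ℂ (fun z => Φ (Function.update p i z)) U

/-- `cornerC ∅ ∅ p = p` (plumbing). [cite: Balaban1988RG2Cluster, (2.14) p.15] (elementary API for (2.14)) -/
private theorem cornerC_empty (p : ι → ℂ) : cornerC (∅ : Finset ι) ∅ p = p := by
  funext i; simp [cornerC]

/-- Updating a coordinate outside `S` commutes with `cornerC S T` (plumbing).
[cite: Balaban1988RG2Cluster, (2.14) p.15] (elementary API for (2.14)) -/
private theorem cornerC_update {S T : Finset ι} {i : ι} (hi : i ∉ S) (p : ι → ℂ) (a : ℂ) :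
    cornerC S T (Function.update p i a) = Function.update (cornerC S T p) i a := by
  funext j
  by_cases hj : j = i
  · subst hj; simp [cornerC, hi]
  · simp [cornerC, Function.update, hj]

/-- Corners of `{0,1}^{insert i S}` with coordinate `i` equal to `1` (plumbing).
[cite: Balaban1988RG2Cluster, (2.14) p.15] (elementary API for (2.14)) -/
private theorem cornerC_insert_insert {S T : Finset ι} {i : ι} (hi : i ∉ S) (p : ι → ℂ) :
    cornerC (insert i S) (insert i T) p = Function.update (cornerC S T p) i 1 := by
  funext j
  by_cases hj : j = i
  · subst hj; simp [cornerC]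
  · simp [cornerC, Function.update, hj]

/-- Corners of `{0,1}^{insert i S}` with coordinate `i` equal to `0` (plumbing).
[cite: Balaban1988RG2Cluster, (2.14) p.15] (elementary API for (2.14)) -/
private theorem cornerC_insert_of_not_mem {S T : Finset ι} {i : ι} (hi : i ∉ S) (hT : i ∉ T) (p : ι → ℂ) :
    cornerC (insert i S) T p = Function.update (cornerC S T p) i 0 := by
  funext j
  by_cases hj : j = i
  · subst hj; simp [cornerC, hT]
  · simp [cornerC, Function.update, hj]

/-- The coordinates of a corner lie in `U` when `0, 1 ∈ U` and the base point does (plumbing).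
[cite: Balaban1988RG2Cluster, (2.14) p.15] (elementary API for (2.14)) -/
private theorem cornerC_mem {U : Set ℂ} (h0 : (0 : ℂ) ∈ U) (h1 : (1 : ℂ) ∈ U) (S T : Finset ι) {p : ι → ℂ}
    (hp : ∀ j, p j ∈ U) (j : ι) : cornerC S T p j ∈ U := by
  unfold cornerC
  split_ifs
  · exact h1
  · exact h0
  · exact hp j

omit [CompleteSpace E] in
/-- `DopC ∅ = id`. [cite: Balaban1988RG2Cluster, (2.14) p.15] (elementary API for (2.14)) -/
theorem DopC_empty (Φ : (ι → ℂ) → E) : DopC (∅ : Finset ι) Φ = Φ := by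
  funext p
  simp [DopC, cornerC_empty]

omit [CompleteSpace E] in
/-- Peeling one parameter: `DopC (insert i S) Φ p = DopC S Φ (p|_{i:=1}) − DopC S Φ (p|_{i:=0})` for `i ∉ S`
(complex-parameter copy of `B13MayerDecoupling.Dop_insert`). [cite: Balaban1988RG2Cluster, (2.14) p.15] (elementary API for (2.14)) -/
theorem DopC_insert {S : Finset ι} {i : ι} (hi : i ∉ S) (Φ : (ι → ℂ) → E) (p : ι → ℂ) :
    DopC (insert i S) Φ p = DopC S Φ (Function.update p i 1) - DopC S Φ (Function.update p i 0) := by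
  simp only [DopC]
  rw [Finset.sum_powerset_insert hi]
  have h1 : ∀ T ∈ S.powerset,
      ((-1 : ℂ) ^ (insert i S \ T).card) • Φ (cornerC (insert i S) T p)
        = -(((-1 : ℂ) ^ (S \ T).card) • Φ (cornerC S T (Function.update p i 0))) := by
    intro T hT
    have hTS : T ⊆ S := Finset.mem_powerset.1 hT
    have hiT : i ∉ T := fun h => hi (hTS h)
    have hcard : (insert i S \ T).card = (S \ T).card + 1 := by
      rw [Finset.insert_sdiff_of_notMem _ hiT, Finset.card_insert_of_notMem]
      exact fun h => hi (Finset.mem_sdiff.1 h).1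
    rw [hcard, pow_succ, cornerC_insert_of_not_mem hi hiT, cornerC_update hi, mul_neg_one,
      neg_smul]
  have h2 : ∀ T ∈ S.powerset,
      ((-1 : ℂ) ^ (insert i S \ insert i T).card) • Φ (cornerC (insert i S) (insert i T) p)
        = ((-1 : ℂ) ^ (S \ T).card) • Φ (cornerC S T (Function.update p i 1)) := by
    intro T hT
    have hTS : T ⊆ S := Finset.mem_powerset.1 hT
    have hsd : insert i S \ insert i T = S \ T := by
      ext j
      simp only [Finset.mem_sdiff, Finset.mem_insert]
      constructor
      · rintro ⟨h1 | h1, h2⟩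
        · exact absurd (Or.inl h1) h2
        · exact ⟨h1, fun h => h2 (Or.inr h)⟩
      · rintro ⟨h1, h2⟩
        exact ⟨Or.inr h1, fun h => h.elim (fun h' => hi (h' ▸ h1)) h2⟩
    rw [hsd, cornerC_insert_insert hi, cornerC_update hi]
  rw [Finset.sum_congr rfl h1, Finset.sum_congr rfl h2, Finset.sum_neg_distrib]
  abel

omit [CompleteSpace E] in
/-- A function of the parameters that is separately holomorphic gives, at the corners, finite sums holomorphic in a
fresh parameter `i ∉ S`: `z ↦ DopC S Φ (p|_{i:=z})` is holomorphic on `U` (plumbing).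
[cite: Balaban1988RG2Cluster, (2.14) p.15] (elementary API for (2.14)) -/
private theorem differentiableOn_DopC {U : Set ℂ} (h0 : (0 : ℂ) ∈ U) (h1 : (1 : ℂ) ∈ U) {Φ : (ι → ℂ) → E}
    (hΦ : SepHolOn U Φ) {S : Finset ι} {i : ι} (hi : i ∉ S) {p : ι → ℂ} (hp : ∀ j, p j ∈ U) :
    DifferentiableOn ℂ (fun z => DopC S Φ (Function.update p i z)) U := by
  have key : ∀ z, DopC S Φ (Function.update p i z)
      = ∑ T ∈ S.powerset, ((-1 : ℂ) ^ (S \ T).card) • Φ (Function.update (cornerC S T p) i z) := by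
    intro z
    simp only [DopC]
    exact Finset.sum_congr rfl fun T _ => by rw [cornerC_update hi]
  simp_rw [key]
  refine DifferentiableOn.fun_sum fun T _ => ?_
  exact (hΦ i (cornerC S T p) (cornerC_mem h0 h1 S T hp)).const_smul _

omit [CompleteSpace E] in
/-- Congruence of the printed operator: `TopC` evaluates its argument only at parameter points with all coordinates
in `U` (the circles `|σ − s| = r`, `s ∈ [0,1]`, lie in `U`), so two functions agreeing there have the same `TopC`.
[cite: Balaban1988RG2Cluster, (2.14) p.15] (elementary API for (2.14)) -/
theorem TopC_congr {U : Set ℂ} {r : ℝ} (hr : 0 < r) (hsub : ∀ s ∈ Set.uIcc (0 : ℝ) 1, closedBall (s : ℂ) r ⊆ U)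
    {Φ Φ' : (ι → ℂ) → E} (hΦ : ∀ q : ι → ℂ, (∀ j, q j ∈ U) → Φ q = Φ' q) :
    ∀ (l : List ι) (p : ι → ℂ), (∀ j, p j ∈ U) → TopC r l Φ p = TopC r l Φ' p := by
  intro l
  induction l with
  | nil => intro p hp; exact hΦ p hp
  | cons i l ih =>
    intro p hp
    simp only [TopC]
    refine intervalIntegral.integral_congr fun s hs => ?_
    simp only [cauchyD]
    congr 1
    refine circleIntegral.integral_congr hr.le fun z hz => ?_
    have hzU : z ∈ U := hsub s hs (sphere_subset_closedBall hz)
    rw [ih (Function.update p i z) (fun j => by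
      rcases eq_or_ne j i with rfl | hj
      · simpa using hzU
      · simpa [Function.update, hj] using hp j)]

/-- **The Cauchy form of (2.14) equals the difference form of (2.8)/(2.1)**: for `Φ` separately holomorphic in each
parameter on an open `U` containing the closed `r`-discs about `[0, 1]`, and a list `l` of distinct parameters,
`(Π_{i∈l} ∫₀¹ds(i)(1/2πi)∮dσ(i)/(σ(i) − s(i))²) Φ (p) = Σ_{T⊆l} (−1)^{|l∖T|} Φ(corner l T p)` — one Cauchy formula and
one fundamental theorem of calculus per parameter (`integral_cauchyD_eq_sub`), induction on `l`.
[cite: Balaban1988RG2Cluster, (2.14) p.15] -/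
theorem TopC_eq_DopC {U : Set ℂ} (hU : IsOpen U) {r : ℝ} (hr : 0 < r)
    (hsub : ∀ s ∈ Set.uIcc (0 : ℝ) 1, closedBall (s : ℂ) r ⊆ U) {Φ : (ι → ℂ) → E} (hΦ : SepHolOn U Φ) :
    ∀ (l : List ι), l.Nodup → ∀ p : ι → ℂ, (∀ j, p j ∈ U) → TopC r l Φ p = DopC l.toFinset Φ p := by
  have h0 : (0 : ℂ) ∈ U := by
    simpa using hsub 0 (by simp) (mem_closedBall_self hr.le)
  have h1 : (1 : ℂ) ∈ U := by
    simpa using hsub 1 (by simp) (mem_closedBall_self hr.le)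
  intro l
  induction l with
  | nil => intro _ p _; simp [TopC, DopC_empty]
  | cons i l ih =>
    intro hnd p hp
    obtain ⟨hi, hl⟩ := List.nodup_cons.1 hnd
    have hi' : i ∉ l.toFinset := by simpa using hi
    simp only [TopC, List.toFinset_cons]
    -- the integrand agrees, on parameter points in `U`, with the holomorphic finite sum `z ↦ DopC l Φ (p|_{i:=z})`
    have hmemz : ∀ z ∈ U, ∀ j, Function.update p i z j ∈ U := by
      intro z hz j
      rcases eq_or_ne j i with rfl | hj
      · simpa using hz
      · simpa [Function.update, hj] using hp j
    have hcongr : ∀ s ∈ Set.uIcc (0 : ℝ) 1,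
        cauchyD r (fun z => TopC r l Φ (Function.update p i z)) s
          = cauchyD r (fun z => DopC l.toFinset Φ (Function.update p i z)) s := by
      intro s hs
      simp only [cauchyD]
      congr 1
      refine circleIntegral.integral_congr hr.le fun z hz => ?_
      have hzU : z ∈ U := hsub s hs (sphere_subset_closedBall hz)
      rw [ih hl _ (hmemz z hzU)]
    rw [intervalIntegral.integral_congr hcongr,
      integral_cauchyD_eq_sub hU (differentiableOn_DopC h0 h1 hΦ hi' hp) hr hsub, DopC_insert hi']

/-- **(2.14) as an operator on a function of the two parameter families**: the printed
`Π_{Δ⊂Z∖Z′₀}∫₀¹ds(Δ)(1/2πi)∮dσ(Δ)/(σ(Δ)−s(Δ))² Π_{Y∈𝐃}∫₀¹dt(Y)(1/2πi)∮dτ(Y)/(τ(Y)−t(Y))²` applied to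
`Ψ(σ, τ)` = the last three lines of (2.14) (`core214` below for the block model), the parameters outside the lists held
at the base points `σ₀`, `τ₀` (print: `s = 0` on `σ₀∖(Z∖Z′₀)`, (2.8); the `t`'s all integrated, (2.1)).
[cite: Balaban1988RG2Cluster, (2.14) p.15] -/
def term214 {κ : Type*} [DecidableEq κ] (r : ℝ) (lZ : List ι) (lD : List κ) (Ψ : (ι → ℂ) → (κ → ℂ) → E)
    (σ₀ : ι → ℂ) (τ₀ : κ → ℂ) : E :=
  TopC r lZ (fun σ => TopC r lD (fun τ => Ψ σ τ) τ₀) σ₀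

/-- **(2.14) = the (2.8)×(2.1) difference form**: if `Ψ(σ, τ)` is separately holomorphic in the `σ(Δ)` (for every
admissible `τ`) and in the `τ(Y)` (for every admissible `σ`) on an open `U` containing the closed `r`-discs about
`[0, 1]`, then `term214` equals the double iterated difference `D_{Z∖Z′₀}^σ D_{𝐃}^τ Ψ` at the base points — the term of
`H(Z, Z₀)` produced by (2.8) (`B13Sect2Statements.H28`, `B13MayerDecoupling.Dop`) and (2.1)
(`B13MayerDecoupling.mayer_expansion_21`) before the Cauchy rewriting. [cite: Balaban1988RG2Cluster, (2.14) p.15] -/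
theorem term214_eq_DopC {κ : Type*} [DecidableEq κ] {U : Set ℂ} (hU : IsOpen U) {r : ℝ} (hr : 0 < r)
    (hsub : ∀ s ∈ Set.uIcc (0 : ℝ) 1, closedBall (s : ℂ) r ⊆ U) {Ψ : (ι → ℂ) → (κ → ℂ) → E}
    (hΨσ : ∀ τ : κ → ℂ, (∀ j, τ j ∈ U) → SepHolOn U (fun σ => Ψ σ τ))
    (hΨτ : ∀ σ : ι → ℂ, (∀ j, σ j ∈ U) → SepHolOn U (fun τ => Ψ σ τ))
    {lZ : List ι} (hlZ : lZ.Nodup) {lD : List κ} (hlD : lD.Nodup) {σ₀ : ι → ℂ} (hσ₀ : ∀ j, σ₀ j ∈ U)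
    {τ₀ : κ → ℂ} (hτ₀ : ∀ j, τ₀ j ∈ U) :
    term214 r lZ lD Ψ σ₀ τ₀ = DopC lZ.toFinset (fun σ => DopC lD.toFinset (fun τ => Ψ σ τ) τ₀) σ₀ := by
  have h0 : (0 : ℂ) ∈ U := by
    simpa using hsub 0 (by simp) (mem_closedBall_self hr.le)
  have h1 : (1 : ℂ) ∈ U := by
    simpa using hsub 1 (by simp) (mem_closedBall_self hr.le)
  unfold term214
  -- inner operator: Cauchy form = difference form at every admissible `σ`
  have hinner : ∀ σ : ι → ℂ, (∀ j, σ j ∈ U) →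
      TopC r lD (fun τ => Ψ σ τ) τ₀ = DopC lD.toFinset (fun τ => Ψ σ τ) τ₀ :=
    fun σ hσ => TopC_eq_DopC hU hr hsub (hΨτ σ hσ) lD hlD τ₀ hτ₀
  rw [TopC_congr hr hsub hinner lZ σ₀ hσ₀]
  -- outer operator: the difference form in `τ` is a finite sum of functions separately holomorphic in `σ`
  refine TopC_eq_DopC hU hr hsub ?_ lZ hlZ σ₀ hσ₀
  intro i p hp
  have key : ∀ z, DopC lD.toFinset (fun τ => Ψ (Function.update p i z) τ) τ₀
      = ∑ T ∈ lD.toFinset.powerset, ((-1 : ℂ) ^ (lD.toFinset \ T).card) •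
          Ψ (Function.update p i z) (cornerC lD.toFinset T τ₀) := fun z => rfl
  simp_rw [key]
  refine DifferentiableOn.fun_sum fun T _ => ?_
  exact (hΨσ (cornerC lD.toFinset T τ₀) (cornerC_mem h0 h1 _ T hτ₀) i p hp).const_smul _

end CauchyDevice

/-! ## Part B. The integrand of (2.14) over the block model (complex operators, real fields) -/

section Integrand

variable {Λ : Type} [Fintype Λ] [DecidableEq Λ]

/-- The complex quadratic form of a COMPLEX matrix at a REAL field, `⟨v, Av⟩ = Σ v_i A_{ij} v_j` (the exponents of
(2.14) at complex `σ(Z)`: *"the operators in it are not symmetric"*; same expression as in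
`B13PerturbativeStep.re_quadForm`). [cite: Balaban1988RG2Cluster, (2.14) p.15] -/
def cquad (A : Matrix Λ Λ ℂ) (v : Λ → ℝ) : ℂ := ∑ i, ∑ j, (v i : ℂ) * A i j * (v j : ℂ)

/-- The complex Gaussian weight `exp(−½⟨B, AB⟩)` of precision `A` (`A⁻¹ = C^{(k)}(Z₀, σ(Z))`, complex for complex
`σ(Z)`: *"the second measure is complex"*). [cite: Balaban1988RG2Cluster, (2.14) p.15] -/
def cgaussWeight (A : Matrix Λ Λ ℂ) (v : Λ → ℝ) : ℂ := Complex.exp (-(1 / 2 : ℂ) * cquad A v)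

/-- The unnormalised complex Gaussian integral `∫dB exp(−½⟨B, AB⟩) Ψ(B)` (Lebesgue `dB` on the real coordinates).
[cite: Balaban1988RG2Cluster, (2.14) p.15] -/
def cgaussInt (A : Matrix Λ Λ ℂ) (Ψ : (Λ → ℝ) → ℂ) : ℂ := ∫ v, cgaussWeight A v * Ψ v

/-- The complex normalisation `∫dB exp(−½⟨B, AB⟩)`. [cite: Balaban1988RG2Cluster, (2.14) p.15] -/
def cgaussNorm (A : Matrix Λ Λ ℂ) : ℂ := ∫ v, cgaussWeight A v

/-- The complex Gaussian MEAN `∫dμ_{A⁻¹}(B) Ψ(B) := (∫dB e^{−½⟨B,AB⟩})⁻¹ ∫dB e^{−½⟨B,AB⟩} Ψ(B)` — the measure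
`dμ_{C^{(k)}(Z₀,σ(Z))}(B)` of (2.14) at complex parameters (the analytic continuation in `σ` of the real Gaussian mean
`B13GaugeDevices.gaussMean`; meaningful when the normalisation is non-zero, e.g. `Re A > 0`).
[cite: Balaban1988RG2Cluster, (2.14) p.15] -/
def cgaussMean (A : Matrix Λ Λ ℂ) (Ψ : (Λ → ℝ) → ℂ) : ℂ := (cgaussNorm A)⁻¹ * cgaussInt A Ψ

omit [DecidableEq Λ] in
/-- **First step of (2.15) for this weight**: `|exp(−½⟨B, AB⟩)| = exp(−½⟨B, (Re A)B⟩)` — the modulus of the complex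
Gaussian weight is the Gaussian weight of `Re A` (`B13PerturbativeStep.norm_cexp_neg_half_quadForm`).
[cite: Balaban1988RG2Cluster, (2.14)–(2.15) p.15] -/
theorem norm_cgaussWeight (A : Matrix Λ Λ ℂ) (v : Λ → ℝ) :
    ‖cgaussWeight A v‖ = Real.exp (-(1 / 2 : ℝ) * ∑ i, ∑ j, v i * (A i j).re * v j) :=
  B13PerturbativeStep.norm_cexp_neg_half_quadForm A v

variable {C : Type} [Fintype C] [DecidableEq C]

/-- **`Γ_k(Z₀, σ(Z)) = C\*Δ_k(σ(Z))CZ₀ᶜ(C^{(k)})^{1/2}(σ(Z))`** (p. 15, after (2.14)) as the composite of the two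
σ-dependent operator families it is printed as, in the block model of `B13Sect2Statements` Part A: `M` = the block
`Z₀(C*Δ_k(σ)C)Z₀ᶜ` (interior rows `Λ`, exterior columns `C`) and `T = (C^{(k)})^{1/2}(σ)` on the whole bond set
`Λ ⊕ C`, both COMPLEX; acting on the real white noise `X`: `Γ X = M·(Z₀ᶜ-part of T X)`.  At real parameters this is
`B13Sect2Statements.gamma26` (`Gamma214_real`). [cite: Balaban1988RG2Cluster, (2.14) p.15] -/
def Gamma214 (M : Matrix Λ C ℂ) (T : Matrix (Λ ⊕ C) (Λ ⊕ C) ℂ) (X : Λ ⊕ C → ℝ) : Λ → ℂ :=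
  M *ᵥ fun c => (T *ᵥ fun b => (X b : ℂ)) (Sum.inr c)

omit [DecidableEq Λ] [DecidableEq C] in
/-- At REAL operators `Γ_k(Z₀, σ)` is the real `Γ` of (2.6) (`B13Sect2Statements.gamma26`, the `σ = 1` object)
coordinatewise. [cite: Balaban1988RG2Cluster, (2.14) p.15] -/
theorem Gamma214_real (M : Matrix Λ C ℝ) (T : Matrix (Λ ⊕ C) (Λ ⊕ C) ℝ) (X : Λ ⊕ C → ℝ) :
    Gamma214 (M.map (algebraMap ℝ ℂ)) (T.map (algebraMap ℝ ℂ)) X = fun i => ((gamma26 M T X i : ℝ) : ℂ) := by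
  funext i
  simp only [Gamma214, gamma26, Matrix.mulVec, dotProduct, Matrix.map_apply, Complex.coe_algebraMap,
    Complex.ofReal_sum, Complex.ofReal_mul]

variable {D : Type*}

/-- **The last line of (2.14)**: `(−1)^{|P|} χ_{k,Y₀}(B) χᶜ_{k,P}(B) exp[Σ_{Y∈𝐃} τ(Y)𝐕_k(Y, B)]` — the sign and the
characteristic functions of the decomposition (2.3) (`B13MayerDecoupling.charFn_decomposition_23`; here abstract real
functions `χY₀`, `χcP` of the interior field and the number `|P|` of large-field bonds) times the `τ`-interpolated
Boltzmann factor of the Mayer expansion (2.1) over the sub-family `𝐃` with potentials `V Y = 𝐕_k(Y, ·)`.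
[cite: Balaban1988RG2Cluster, (2.14) p.15] -/
def F214 (cardP : ℕ) (χY₀ χcP : (Λ → ℝ) → ℝ) (Dfam : Finset D) (V : D → (Λ → ℝ) → ℂ) (τ : D → ℂ)
    (B : Λ → ℝ) : ℂ :=
  (-1) ^ cardP * (χY₀ B : ℂ) * (χcP B : ℂ) * Complex.exp (∑ Y ∈ Dfam, τ Y * V Y B)

/-- **Lines 2–3 of (2.14)** as a function of the white noise `X`:
`exp(−½⟨ΓX, C^{(k)}(Z₀, σ)ΓX⟩) · ∫dμ_{C^{(k)}(Z₀,σ)}(B) exp(−⟨B, ΓX⟩) F(B)` with `Γ = Γ_k(Z₀, σ(Z))`, precision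
`A = C^{(k)}(Z₀, σ)⁻¹` (so the first exponent is `−½⟨ΓX, A⁻¹ΓX⟩`, a complex-bilinear pairing) and `F` the last line —
the complex-parameter form of the function `G` of (2.6) (`B13Sect2Statements.G26`, real operators).
[cite: Balaban1988RG2Cluster, (2.14) p.15] -/
def integrand214 (A : Matrix Λ Λ ℂ) (Γ : (Λ ⊕ C → ℝ) → (Λ → ℂ)) (F : (Λ → ℝ) → ℂ) (X : Λ ⊕ C → ℝ) : ℂ :=
  Complex.exp (-(1 / 2 : ℂ) * (Γ X ⬝ᵥ (A⁻¹ *ᵥ Γ X)))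
    * cgaussMean A (fun B => Complex.exp (-((fun i => (B i : ℂ)) ⬝ᵥ Γ X)) * F B)

/-- **The `X`-integral of (2.14)**, `∫dμ₀(X)|_Z (lines 2–4)`, as a function `Ψ(σ, τ)` of the complex parameters:
`dμ₀(X)|_Z` = the normalised standard Gaussian on the real coordinates of `X` inside `Z` (here: all of `Λ ⊕ C`, the
restriction being the choice of the index sets), the operators `A(σ) = C^{(k)}(Z₀, σ(Z))⁻¹`, `Γ(σ) = Γ_k(Z₀, σ(Z))`
σ-dependent families (their construction — random-walk expansions with the parameters `s` — is Sect. 1/p. 13, by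
reference), the last line `F(τ, ·)` τ-dependent. [cite: Balaban1988RG2Cluster, (2.14) p.15] -/
def core214 {ι : Type*} (A : (ι → ℂ) → Matrix Λ Λ ℂ) (Γ : (ι → ℂ) → (Λ ⊕ C → ℝ) → (Λ → ℂ))
    (F : (D → ℂ) → (Λ → ℝ) → ℂ) (σ : ι → ℂ) (τ : D → ℂ) : ℂ :=
  cgaussMean (1 : Matrix (Λ ⊕ C) (Λ ⊕ C) ℂ) fun X => integrand214 (A σ) (Γ σ) (F τ) X

/-- **(2.14) assembled** for the block model: the display is `term214 r (Z∖Z′₀) 𝐃 (core214 A Γ F) σ₀ τ₀` — the printed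
Cauchy operators in `σ(Δ)`, `Δ ∈ Z∖Z′₀`, and `τ(Y)`, `Y ∈ 𝐃`, applied to the `X`-integral; by `term214_eq_DopC` it is
the corresponding term of `H(Z, Z₀)` in difference form whenever `core214 A Γ F` is separately holomorphic in the
parameters (p. 15: *"We consider it as an analytic function … of the complex parameters σ(Z), τ"*).  A `def` (the
printed object); nothing about it is asserted. [cite: Balaban1988RG2Cluster, (2.14) p.15] -/
def display214 {ι : Type*} [DecidableEq ι] [DecidableEq D] (r : ℝ) (lZ : List ι) (lD : List D)
    (A : (ι → ℂ) → Matrix Λ Λ ℂ) (Γ : (ι → ℂ) → (Λ ⊕ C → ℝ) → (Λ → ℂ)) (F : (D → ℂ) → (Λ → ℝ) → ℂ)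
    (σ₀ : ι → ℂ) (τ₀ : D → ℂ) : ℂ :=
  term214 r lZ lD (core214 A Γ F) σ₀ τ₀

end Integrand

/-! ## Part C (v1.1, append-only). The real-parameter bridge: at real operators the objects of (2.14) are those of
(2.6)/(2.8) -/

section RealBridge

open Literature.MathematicalPhysics.QuantumFieldTheory.Balaban1983to89.B13GaugeDevices
  (gaussWeight gaussInt gaussNorm gaussMean)
open Literature.MathematicalPhysics.QuantumFieldTheory.Balaban1983to89.B13Sect2Statements (G26)

variable {Λ : Type} [Fintype Λ] [DecidableEq Λ]

omit [DecidableEq Λ] in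
/-- At a REAL matrix the complex quadratic form is the real one: `⟨v, Av⟩_ℂ = ↑⟨v, Av⟩`.
[cite: Balaban1988RG2Cluster, (2.14) p.15] (elementary API for (2.14)) -/
theorem cquad_real (A : Matrix Λ Λ ℝ) (v : Λ → ℝ) :
    cquad (A.map (algebraMap ℝ ℂ)) v = ((v ⬝ᵥ (A *ᵥ v) : ℝ) : ℂ) := by
  simp only [cquad, Matrix.map_apply, Complex.coe_algebraMap, dotProduct, Matrix.mulVec, Complex.ofReal_sum,
    Complex.ofReal_mul, Finset.mul_sum]
  refine Finset.sum_congr rfl fun i _ => Finset.sum_congr rfl fun j _ => by ring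

omit [DecidableEq Λ] in
/-- At a REAL precision the complex Gaussian weight of (2.14) is the real weight `exp(−½⟨B, AB⟩)` of (2.6)
(`B13GaugeDevices.gaussWeight`). [cite: Balaban1988RG2Cluster, (2.14) p.15] -/
theorem cgaussWeight_real (A : Matrix Λ Λ ℝ) (v : Λ → ℝ) :
    cgaussWeight (A.map (algebraMap ℝ ℂ)) v = ((gaussWeight A v : ℝ) : ℂ) := by
  rw [cgaussWeight, cquad_real, gaussWeight, Complex.ofReal_exp]
  congr 1
  push_cast
  ring

omit [DecidableEq Λ] in
/-- … hence the complex normalisation is the real one (`B13GaugeDevices.gaussNorm`).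
[cite: Balaban1988RG2Cluster, (2.14) p.15] -/
theorem cgaussNorm_real (A : Matrix Λ Λ ℝ) : cgaussNorm (A.map (algebraMap ℝ ℂ)) = ((gaussNorm A : ℝ) : ℂ) := by
  simp only [cgaussNorm, cgaussWeight_real, gaussNorm]
  exact integral_complex_ofReal

omit [DecidableEq Λ] in
/-- … and the complex Gaussian integral is the real one (`B13GaugeDevices.gaussInt`, complex-valued integrand).
[cite: Balaban1988RG2Cluster, (2.14) p.15] -/
theorem cgaussInt_real (A : Matrix Λ Λ ℝ) (Ψ : (Λ → ℝ) → ℂ) :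
    cgaussInt (A.map (algebraMap ℝ ℂ)) Ψ = gaussInt A Ψ := by
  simp only [cgaussInt, cgaussWeight_real, gaussInt, Complex.real_smul]

omit [DecidableEq Λ] in
/-- **The complex measure of (2.14) at a REAL precision IS the Gaussian mean of (2.6)**:
`cgaussMean (A : real) Ψ = ∫dμ_{A⁻¹}(B)Ψ(B)` (`B13GaugeDevices.gaussMean`; print p. 15: the measure
`dμ_{C^{(k)}(Z₀,σ(Z))}` is *"complex"* only through the complex parameters `σ(Z)`).
[cite: Balaban1988RG2Cluster, (2.14) p.15] -/
theorem cgaussMean_real (A : Matrix Λ Λ ℝ) (Ψ : (Λ → ℝ) → ℂ) :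
    cgaussMean (A.map (algebraMap ℝ ℂ)) Ψ = gaussMean A Ψ := by
  rw [cgaussMean, cgaussNorm_real, cgaussInt_real, gaussMean, Complex.real_smul, Complex.ofReal_inv]

/-- A field homomorphism commutes with the nonsingular inverse: `(A.map ofReal)⁻¹ = A⁻¹.map ofReal` (both sides the
junk `0`-multiple when `det A = 0`) (plumbing). [cite: Balaban1988RG2Cluster, (2.14) p.15] (elementary API for (2.14)) -/
private theorem map_ofReal_inv (A : Matrix Λ Λ ℝ) : (A.map (algebraMap ℝ ℂ))⁻¹ = A⁻¹.map (algebraMap ℝ ℂ) := by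
  rw [Matrix.inv_def, Matrix.inv_def,
    show (A.map (algebraMap ℝ ℂ)).det = algebraMap ℝ ℂ A.det from (RingHom.map_det (algebraMap ℝ ℂ) A).symm,
    show (A.map (algebraMap ℝ ℂ)).adjugate = A.adjugate.map (algebraMap ℝ ℂ) from
      (RingHom.map_adjugate (algebraMap ℝ ℂ) A).symm,
    Matrix.map_smul' _ _ _ (fun a b => map_mul (algebraMap ℝ ℂ) a b)]
  simp only [Ring.inverse_eq_inv', map_inv₀]

variable {C : Type} [Fintype C] [DecidableEq C]

omit [DecidableEq C] in
/-- **Lines 2–3 of (2.14) at REAL operators ARE the function `G` of (2.6)**: with the precision `A`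
(`A⁻¹ = C^{(k)}(Z₀)`), the block `M = Z₀C*Δ_kCZ₀ᶜ` and `T = (C^{(k)})^{1/2}` real,
`integrand214 A (Γ_k(Z₀, ·)) F X = G(Z₀, X, C^{(k)}(Z₀), (C^{(k)})^{1/2}, Δ_k)` of `B13Sect2Statements.G26` (for
complex-valued last line `F`; `Gamma214_real`, `cgaussMean_real`, and the symmetry `⟨B, ΓX⟩ = ⟨ΓX, B⟩`) — the
`σ(Z) = 1` endpoint at which (2.8) evaluates the undecoupled integrand. [cite: Balaban1988RG2Cluster, (2.14) p.15] -/
theorem integrand214_real (F : (Λ → ℝ) → ℂ) (A : Matrix Λ Λ ℝ) (M : Matrix Λ C ℝ)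
    (T : Matrix (Λ ⊕ C) (Λ ⊕ C) ℝ) (X : Λ ⊕ C → ℝ) :
    integrand214 (A.map (algebraMap ℝ ℂ)) (Gamma214 (M.map (algebraMap ℝ ℂ)) (T.map (algebraMap ℝ ℂ))) F X
      = G26 F A M T X := by
  rw [integrand214, Gamma214_real, map_ofReal_inv, G26, cgaussMean_real, Complex.real_smul, Complex.ofReal_exp]
  have hq : (fun i => ((gamma26 M T X i : ℝ) : ℂ)) ⬝ᵥ (A⁻¹.map (algebraMap ℝ ℂ) *ᵥ fun i => ((gamma26 M T X i : ℝ) : ℂ))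
      = (((gamma26 M T X ⬝ᵥ (A⁻¹ *ᵥ gamma26 M T X)) : ℝ) : ℂ) := by
    simp only [dotProduct, Matrix.mulVec, Matrix.map_apply, Complex.coe_algebraMap, Complex.ofReal_sum,
      Complex.ofReal_mul]
  rw [hq]
  congr 1
  · push_cast; ring_nf
  · congr 1
    funext x
    rw [Complex.real_smul, Complex.ofReal_exp, dotProduct_comm]
    congr 2
    simp only [dotProduct, Complex.ofReal_sum, Complex.ofReal_mul, Complex.ofReal_neg]

end RealBridge

end Literature.MathematicalPhysics.QuantumFieldTheory.Balaban1983to89.B13Term214
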